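import Literature.NumberTheory.EllipticCurves.IwasawaSelmerControlAwayFromPProofs
import Literature.NumberTheory.EllipticCurves.KodairaNeronLeFourProofs
import Literature.NumberTheory.EllipticCurves.TamagawaSubgroupProofs
import Literature.NumberTheory.EllipticCurves.HasseWeilGoodReductionFrobeniusProofs
import Literature.NumberTheory.EllipticCurves.SingularCubicPointCountProofs
import Literature.NumberTheory.EllipticCurves.VariableChangePointsMap
import Literature.NumberTheory.DiophantineGeometry.TateAlgorithmProofs
import Literature.NumberTheory.DiophantineGeometry.TateAlgorithmOrdDiscriminant
import Literature.NumberTheory.EllipticCurves.ZpExtensionUnramifiedProofs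
import Mathlib.GroupTheory.Perm.Cycle.Type
import Mathlib.FieldTheory.Finite.Basic
import HarnessLib

/-!
# `#E(K_v)[n] ∣ [E(K_v) : E₀(K_v)] · #Ẽ_ns(k_v)` for `n` prime to `v`, and the three reduction types
# (Silverman, *AEC* VII.2.1, VII.3.1, VII.6.1; the order `#E(K_w)[p^∞]` against the Euler factor `P_w(1)`)

Topic `NumberTheory/EllipticCurves`; namespace `WeierstrassCurve`. `Proofs`-style file: THEOREMS ONLY
(no definition, no named fact, no instance, no `sorry`). Cell `bsd-stepL`, K2 support 20495
`JSWSigmaLocalCharIdeal` (module L4b of the discharge of the local `Σ`-atom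
`JetchevSkinnerWan2017.sigmaLocal_charIdeal_eulerFactor_mem_of_noTamagawaDefect`, c = 0 branch:
"`#E(K_w)[p^∞] = |P_w(Nw⁻¹)|_p⁻¹` when `p ∤ c_w`", module docstring of `SigmaImprimitiveCharIdeal`).

Let `E` be an elliptic curve over a number field `K`, `v` a finite place, `K_v`, `𝓞_v`, `k_v` the
completion, its integers and residue field, `X = E.localMinimalModel v = M ⊗ K_v` the chosen minimal
model (`M = E.localMinimalIntegralModel v` over `𝓞_v`), `Ẽ_v = E.reductionAt v = M mod 𝔪_v` (Mathlib
points of the possibly singular reduced cubic = `Ẽ_ns(k_v) ∪ {O}`), `E₀(K_v)`, `E₁(K_v)` the points with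
nonsingular reduction / the kernel of reduction (tree `ReductionHomomorphism`: `nonsingularReductionSubgroup`,
`kernelOfReduction`, `reductionHom` with kernel `E₁`, Silverman VII.2.1), and `n` a natural number which is
a unit of `𝓞_v` (`v ∤ n`).

* `kernelOfReduction_eq_zero_of_nsmul_eq_zero` — **`E₁(K_v)` has no `n`-torsion** (VII.3.1(a); the
  tree's `val_le_one_of_zsmul_eq_zero` for the spectral valuation restricted to `K_v`, as in
  `finite_setOf_forall_map_eq_and_nsmul_eq_zero`).
* `natCard_torsion_dvd_index_mul_natCard_reduction` — **`#X(K_v)[n] ∣ [X(K_v) : E₀(K_v)] · #Ẽ_v(k_v)`**: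
  `X(K_v)[n] ↪ X(K_v)/E₁(K_v)`, `[X : E₁] = [X : E₀]·[E₀ : E₁]`, `E₀/E₁ ↪ Ẽ_v(k_v)`.
* `natCard_torsion_baseChange_eq` — `#E(K_v)[n] = #X(K_v)[n]` (the minimal model is a change of
  variables of `E ⊗ K_v`).
* The three reduction types (`[X : E₀] = 1`, `≤ 2`, `≤ 4`: tree `goodReductionSubgroup_eq_top_of_hasGoodReduction`,
  `LocalIndex.index_le_two_of_nonsplit`, `index_goodReductionSubgroup_le_four_holds`; `#Ẽ_v(k_v) = q_v + 1`
  at a non-split node, `q_v` at a cusp: `natCard_point_of_Δ_eq_zero`):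
  **`natCard_primePowTorsion_dvd_of_hasGoodReductionAt`** (`#E(K_v)[p^k] ∣ #Ẽ_v(k_v) = q_v + 1 − a_v`),
  **`natCard_primePowTorsion_dvd_of_nonsplit`** (`p` odd: `#E(K_v)[p^k] ∣ q_v + 1`),
  **`natCard_primePowTorsion_eq_one_of_hasAdditiveReductionAt`** (`p ≥ 5`: `E(K_v)[p^k] = 0`), `v ∤ p`.

References: [SilvermanAEC2009] Prop. VII.2.1, Prop. VII.3.1, Thm. VII.6.1, Ex. 3.5;
[SilvermanATAEC1994] Cor. IV.9.2(d), IV.9.4 Step 2; [Castella2018] Thm. 2.3 (2.7), Prop. 2.5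
(`t_E(w) = ord_p c_w(E/K)`); [GreenbergLNM1716] §3 Lemma 3.3.
-/

noncomputable section

open scoped Classical NNReal

universe u

namespace WeierstrassCurve

open Literature.NumberTheory.EllipticCurves Literature.NumberTheory.GaloisRepresentations
  Field IsDedekindDomain IsDedekindDomain.HeightOneSpectrum NumberField IsLocalRing

variable {K : Type u} [Field K] [NumberField K] (E : WeierstrassCurve K)
  (v : HeightOneSpectrum (𝓞 K))

/-! ## §1. `E₁(K_v)` has no torsion of order prime to `v` -/

/-- **`E₁(K_v)[n] = 0` for `n` a unit of `𝓞_v`** (Silverman, *AEC* VII.3.1(a)): on the minimal model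
`X = M ⊗ K_v` at `v`, a point of the kernel of reduction (`x ∉ 𝓞_v`) killed by `n` is `O` — by the
tree's `val_le_one_of_zsmul_eq_zero` (an affine `n`-torsion point with `|n| = 1` is integral) for the
spectral valuation of `K̄_v` restricted to `K_v`. [cite: SilvermanAEC2009, Prop. VII.3.1] -/
theorem kernelOfReduction_eq_zero_of_nsmul_eq_zero {n : ℕ}
    (hn : IsUnit ((n : ℕ) : v.adicCompletionIntegers K))
    {P : ((E.localMinimalIntegralModel v).baseChange (v.adicCompletion K)).toAffine.Point}
    (hP : P ∈ (E.localMinimalIntegralModel v).kernelOfReduction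
      (integers_valuationRing_valuation (v.adicCompletionIntegers K) (v.adicCompletion K)))
    (h0 : n • P = 0) : P = 0 := by
  obtain ⟨w, hw⟩ := v.exists_spectralValuation
  rcases P with _ | ⟨x, y, h⟩
  · rfl
  · exfalso
    have hx : x ∉ Set.range (algebraMap (v.adicCompletionIntegers K) (v.adicCompletion K)) :=
      (reducesToZero_some_iff h).mp hP
    let w' : Valuation (v.adicCompletion K) ℝ≥0 :=
      w.comap (algebraMap (v.adicCompletion K) (AlgebraicClosure (v.adicCompletion K)))
    have hw' : ∀ z : v.adicCompletion K,
        w' z = w (algebraMap (v.adicCompletion K) (AlgebraicClosure (v.adicCompletion K)) z) :=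
      fun z ↦ rfl
    have hint : ∀ a : v.adicCompletionIntegers K,
        w' (algebraMap (v.adicCompletionIntegers K) (v.adicCompletion K) a) ≤ 1 := fun a ↦ by
      rw [hw']; exact (spectralValuation_algebraMap_le_one_iff hw _).mpr a.2
    haveI : ((E.localMinimalIntegralModel v).baseChange (v.adicCompletion K)).IsIntegral w'.integer :=
      isIntegral_integer_of_val_le_one (hint _) (hint _) (hint _) (hint _) (hint _)
    have hn1 : w' ((n : ℤ) : v.adicCompletion K) = 1 := by
      rw [hw', Int.cast_natCast, map_natCast]
      exact spectralValuation_natCast_eq_one_of_isUnit hw hn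
    have h0' : (n : ℤ) • (Affine.Point.some x y h) = 0 := by rwa [natCast_zsmul]
    have hle : w' x ≤ 1 := val_le_one_of_zsmul_eq_zero hn1 h0'
    rw [hw', spectralValuation_algebraMap_le_one_iff hw] at hle
    exact hx ⟨⟨x, hle⟩, rfl⟩

/-! ## §2. `#X(K_v)[n] ∣ [X(K_v) : E₀(K_v)] · #Ẽ_v(k_v)` -/

/-- **`#X(K_v)[n] ∣ [X(K_v) : E₀(K_v)] · #Ẽ_v(k_v)`** for `n` a unit of `𝓞_v`, on the minimal model
`X = M ⊗ K_v` (Silverman, *AEC* VII.2.1 + VII.3.1): `X(K_v)[n]` meets `E₁(K_v)` trivially (§1), so it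
embeds in `X(K_v)/E₁(K_v)`, of order `[X : E₁] = [X : E₀] · [E₀ : E₁]`, and `E₀/E₁` embeds in `Ẽ_v(k_v)` by
the reduction homomorphism (`reductionHom`, kernel `E₁`: `reductionHom_ker`). Here `E₀` is the tree's
`nonsingularReductionSubgroup` and `Ẽ_v(k_v)` the points of `M mod 𝔪_v` (`= E.reductionAt v`).
[cite: SilvermanAEC2009, Prop. VII.2.1 and Prop. VII.3.1] -/
theorem natCard_torsion_dvd_index_mul_natCard_reduction {n : ℕ}
    (hn : IsUnit ((n : ℕ) : v.adicCompletionIntegers K)) :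
    Nat.card (nsmulAddMonoidHom n :
        ((E.localMinimalIntegralModel v).baseChange (v.adicCompletion K)).toAffine.Point →+ _).ker ∣
      ((E.localMinimalIntegralModel v).nonsingularReductionSubgroup
          (integers_valuationRing_valuation (v.adicCompletionIntegers K) (v.adicCompletion K))).index *
        Nat.card ((E.localMinimalIntegralModel v).map
          (IsLocalRing.residue (v.adicCompletionIntegers K))).toAffine.Point := by
  set hv := integers_valuationRing_valuation (v.adicCompletionIntegers K) (v.adicCompletion K) with hhv
  set M := E.localMinimalIntegralModel v with hM
  set E₀ := M.nonsingularReductionSubgroup hv with hE₀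
  set E₁ := M.kernelOfReduction hv with hE₁
  set T := (nsmulAddMonoidHom n : (M.baseChange (v.adicCompletion K)).toAffine.Point →+ _).ker with hT
  -- `T ↪ X/E₁`
  have hinj : Function.Injective ((QuotientAddGroup.mk' E₁).comp T.subtype) := by
    refine (injective_iff_map_eq_zero _).2 fun P hP => ?_
    have hmem : (P : (M.baseChange (v.adicCompletion K)).toAffine.Point) ∈ E₁ := by
      rw [AddMonoidHom.comp_apply, QuotientAddGroup.mk'_apply, QuotientAddGroup.eq_zero_iff] at hP
      exact hP
    have hP0 : n • (P : (M.baseChange (v.adicCompletion K)).toAffine.Point) = 0 := P.2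
    exact Subtype.ext (E.kernelOfReduction_eq_zero_of_nsmul_eq_zero v hn hmem hP0)
  have h1 : Nat.card T ∣ E₁.index := AddSubgroup.card_dvd_of_injective _ hinj
  -- `[X : E₁] = [E₀ : E₁]·[X : E₀]` and `[E₀ : E₁] = #im(reduction) ∣ #Ẽ_v(k_v)`
  have hle : E₁ ≤ E₀ := kernelOfReduction_le_nonsingularReductionSubgroup hv
  have h2 : E₁.relIndex E₀ * E₀.index = E₁.index := AddSubgroup.relIndex_mul_index hle
  have h3 : E₁.relIndex E₀ = Nat.card (reductionHom M hv).range := by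
    rw [AddSubgroup.relIndex, ← reductionHom_ker hv, AddSubgroup.index_ker]
  have h4 : Nat.card (reductionHom M hv).range ∣
      Nat.card (M.map (IsLocalRing.residue (v.adicCompletionIntegers K))).toAffine.Point :=
    AddSubgroup.card_addSubgroup_dvd_card _
  rw [← h2, h3, mul_comm] at h1
  exact h1.trans (mul_dvd_mul_left _ h4)

/-! ## §3. Transport to `E ⊗ K_v` and the index of `E₀` -/

/-- **`#E(K_v)[n] = #X(K_v)[n]`**: the chosen minimal model `X = M ⊗ K_v` is a change of variables
of `E ⊗ K_v` (`exists_variableChange_eq_localMinimalIntegralModel`), and the induced isomorphism of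
point groups (`VariableChange.pointEquiv`) preserves `n`-torsion. [cite: SilvermanAEC2009, VII.§1 (Prop. VII.1.3)] -/
theorem natCard_torsion_baseChange_eq (n : ℕ) :
    Nat.card (nsmulAddMonoidHom n : (E.baseChange (v.adicCompletion K)).toAffine.Point →+ _).ker =
      Nat.card (nsmulAddMonoidHom n :
        ((E.localMinimalIntegralModel v).baseChange (v.adicCompletion K)).toAffine.Point →+ _).ker := by
  obtain ⟨C, hC⟩ := E.exists_variableChange_eq_localMinimalIntegralModel v
  let e : (E.baseChange (v.adicCompletion K)).toAffine.Point ≃+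
      ((E.localMinimalIntegralModel v).baseChange (v.adicCompletion K)).toAffine.Point :=
    (VariableChange.pointEquiv (E.baseChange (v.adicCompletion K)) C).trans
      (Affine.Point.congrEquiv hC)
  refine Nat.card_congr (e.toEquiv.subtypeEquiv fun P => ?_)
  change n • P = 0 ↔ n • e P = 0
  rw [← map_nsmul, e.map_eq_zero_iff]

/-! ## §4. The three reduction types -/

/-- `p^k` is a unit of `𝓞_v` when `v ∤ p`. [folklore] -/
private theorem isUnit_natCast_pow_adicCompletionIntegers {p : ℕ} (hpv : (p : 𝓞 K) ∉ v.asIdeal) (k : ℕ) :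
    IsUnit (((p ^ k : ℕ) : ℕ) : v.adicCompletionIntegers K) := by
  have h := IsDedekindDomain.HeightOneSpectrum.isUnit_algebraMap_adicCompletionIntegers K v hpv
  rw [map_natCast] at h
  rw [Nat.cast_pow]
  exact h.pow k

/-- **Good reduction: `#E(K_v)[p^k] ∣ #Ẽ_v(k_v)`** (`= q_v + 1 − a_v`), `v ∤ p` (Silverman, *AEC*
VII.3.1(b): "the reduction map is injective on `E(K)[m]`"): `E₀ = E` on the minimal model
(`goodReductionSubgroup_eq_top_of_hasGoodReduction`). [cite: SilvermanAEC2009, Prop. VII.3.1 (b)] -/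
theorem natCard_primePowTorsion_dvd_natCard_reductionAt (hgood : E.HasGoodReductionAt v)
    {p : ℕ} (hpv : (p : 𝓞 K) ∉ v.asIdeal) (k : ℕ) :
    Nat.card (nsmulAddMonoidHom (p ^ k) : (E.baseChange (v.adicCompletion K)).toAffine.Point →+ _).ker ∣
      Nat.card (E.reductionAt v).toAffine.Point := by
  rw [natCard_torsion_baseChange_eq]
  have h := E.natCard_torsion_dvd_index_mul_natCard_reduction v
    (isUnit_natCast_pow_adicCompletionIntegers v hpv k)
  have hX : (E.localMinimalIntegralModel v).baseChange (v.adicCompletion K) = E.localMinimalModel v :=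
    E.map_localMinimalIntegralModel_eq (v := v)
  haveI : ((E.localMinimalIntegralModel v).baseChange (v.adicCompletion K)).HasGoodReduction
      (v.adicCompletionIntegers K) := by
    rw [hX]; exact hgood
  rw [← goodReductionSubgroup_baseChange_eq (v.adicCompletionIntegers K) (E.localMinimalIntegralModel v),
    goodReductionSubgroup_eq_top_of_hasGoodReduction, AddSubgroup.index_top, one_mul] at h
  exact h

/-- The order of a finite additive group killed by a power of the prime `p` is prime to every
`m` not divisible by `p` (Cauchy: a prime `q ∣ #T` is the order of an element, hence divides `p^k`).
[folklore] -/
private theorem coprime_natCard_of_prime_pow_nsmul_eq_zero {T : Type*} [AddCommGroup T] [Finite T]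
    {p : ℕ} (hp : p.Prime) {k : ℕ} (hT : ∀ x : T, p ^ k • x = 0) {m : ℕ} (hm : ¬ p ∣ m) :
    Nat.Coprime (Nat.card T) m := by
  refine Nat.coprime_of_dvd fun q hq hqT hqm => ?_
  haveI : Fact q.Prime := ⟨hq⟩
  obtain ⟨x, hx⟩ := exists_prime_addOrderOf_dvd_card' (G := T) q hqT
  have hdvd : q ∣ p ^ k := by
    rw [← hx]
    exact addOrderOf_dvd_of_nsmul_eq_zero (hT x)
  have hqp : q = p := (Nat.prime_dvd_prime_iff_eq hq hp).mp (hq.dvd_of_dvd_pow hdvd)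
  exact hm (hqp ▸ hqm)

/-- `p ∤ #k_v` when `v ∤ p` (the residue characteristic of `K_v` is not `p`). [folklore] -/
private theorem not_dvd_natCard_residueField {p : ℕ} (hp : p.Prime) (hpv : (p : 𝓞 K) ∉ v.asIdeal) :
    ¬ p ∣ Nat.card (ResidueField (v.adicCompletionIntegers K)) := by
  intro hdvd
  haveI := Fintype.ofFinite (ResidueField (v.adicCompletionIntegers K))
  obtain ⟨n, hprime, hcard⟩ :=
    FiniteField.card (ResidueField (v.adicCompletionIntegers K)) (ringChar (ResidueField (v.adicCompletionIntegers K)))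
  rw [Nat.card_eq_fintype_card, hcard] at hdvd
  have hpeq : p = ringChar (ResidueField (v.adicCompletionIntegers K)) :=
    (Nat.prime_dvd_prime_iff_eq hp hprime).mp (hp.dvd_of_dvd_pow hdvd)
  have h0 : (p : ResidueField (v.adicCompletionIntegers K)) = 0 := by
    rw [hpeq]; exact ringChar.Nat.cast_ringChar
  exact WeierstrassCurve.natCast_residueField_ne_zero (K := K) hpv h0

/-- The node-tangent polynomial of the reduced cubic `M mod 𝔪` is the reduction of that of `M`.
[folklore] -/
private theorem nodePoly_map_residue {R : Type*} [CommRing R] [IsLocalRing R] (M : WeierstrassCurve R) :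
    (Polynomial.C (M.map (residue R)).c₄ * Polynomial.X ^ 2 +
        Polynomial.C ((M.map (residue R)).a₁ * (M.map (residue R)).c₄) * Polynomial.X -
        Polynomial.C (54 * (M.map (residue R)).b₆ - 3 * (M.map (residue R)).b₂ * (M.map (residue R)).b₄ +
          (M.map (residue R)).a₂ * (M.map (residue R)).c₄)) =
      Polynomial.map (algebraMap R (ResidueField R))
        (Polynomial.C M.c₄ * Polynomial.X ^ 2 + Polynomial.C (M.a₁ * M.c₄) * Polynomial.X -
          Polynomial.C (54 * M.b₆ - 3 * M.b₂ * M.b₄ + M.a₂ * M.c₄)) := by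
  simp only [map_c₄, map_a₁, map_a₂, map_b₂, map_b₄, map_b₆, Polynomial.map_sub, Polynomial.map_add,
    Polynomial.map_mul, Polynomial.map_pow, Polynomial.map_C, Polynomial.map_X, map_sub, map_add,
    map_mul, map_ofNat, Polynomial.map_ofNat, ResidueField.algebraMap_eq]

/-- **Non-split multiplicative reduction: `#E(K_v)[p^k] ∣ q_v + 1`** for an odd prime `p` with `v ∤ p`
(Silverman, *AEC* VII.2.1, VII.3.1 and *ATAEC* IV.9.4 Step 2): `[X : E₀] ∈ {1, 2}`
(`LocalIndex.index_le_two_of_nonsplit`) and `#Ẽ_ns(k_v) = q_v + 1` at a non-split node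
(`natCard_point_of_Δ_eq_zero`), while `#E(K_v)[p^k]` is odd. This is "`t_E(w) = ord_p c_w = 0`,
`#E(K_w)[p^∞] = (q_w + 1)_p`" of [Castella2018] Prop. 2.5. [cite: SilvermanAEC2009, Prop. VII.2.1, Prop. VII.3.1 and Ex. 3.5]
[cite: SilvermanATAEC1994, IV.9.4 Step 2 (PDF p. 344)] [cite: Castella2018, Prop. 2.5] -/
theorem natCard_primePowTorsion_dvd_of_nonsplit [E.IsElliptic] (hmult : E.HasMultiplicativeReductionAt v)
    (hns : ¬ E.HasSplitMultiplicativeReductionAt v) {p : ℕ} (hp : p.Prime) (hp2 : p ≠ 2)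
    (hpv : (p : 𝓞 K) ∉ v.asIdeal) (k : ℕ) :
    Nat.card (nsmulAddMonoidHom (p ^ k) : (E.baseChange (v.adicCompletion K)).toAffine.Point →+ _).ker ∣
      Nat.card (ResidueField (v.adicCompletionIntegers K)) + 1 := by
  rw [natCard_torsion_baseChange_eq]
  have h := E.natCard_torsion_dvd_index_mul_natCard_reduction v
    (isUnit_natCast_pow_adicCompletionIntegers v hpv k)
  obtain ⟨hΔm, hc₄⟩ := (hasMultiplicativeReductionAt_iff_mem v E).mp hmult
  have hX : (E.localMinimalIntegralModel v).baseChange (v.adicCompletion K) = E.localMinimalModel v :=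
    E.map_localMinimalIntegralModel_eq (v := v)
  haveI : ((E.localMinimalIntegralModel v).baseChange (v.adicCompletion K)).IsMinimal
      (v.adicCompletionIntegers K) := E.isMinimal_map_localMinimalIntegralModel (v := v)
  have hmult' : ((E.localMinimalIntegralModel v).baseChange (v.adicCompletion K)).HasMultiplicativeReduction
      (v.adicCompletionIntegers K) := by
    rw [hX]; exact hmult
  have hnsplits : ¬ (Polynomial.map (algebraMap (v.adicCompletionIntegers K)
      (ResidueField (v.adicCompletionIntegers K)))
      (Polynomial.C (E.localMinimalIntegralModel v).c₄ * Polynomial.X ^ 2 +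
        Polynomial.C ((E.localMinimalIntegralModel v).a₁ * (E.localMinimalIntegralModel v).c₄) * Polynomial.X -
        Polynomial.C (54 * (E.localMinimalIntegralModel v).b₆ -
          3 * (E.localMinimalIntegralModel v).b₂ * (E.localMinimalIntegralModel v).b₄ +
          (E.localMinimalIntegralModel v).a₂ * (E.localMinimalIntegralModel v).c₄))).Splits := by
    intro hsplit
    apply hns
    have hsm : ((E.localMinimalIntegralModel v).baseChange (v.adicCompletion K)).HasSplitMultiplicativeReduction
        (v.adicCompletionIntegers K) := by
      haveI := hmult'
      refine ⟨?_⟩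
      rw [integralModel_baseChange_eq]
      exact hsplit
    rw [hX] at hsm
    exact hsm
  -- `[X : E₀] ∈ {1, 2}`
  have hidx := LocalIndex.index_le_two_of_nonsplit (K := v.adicCompletion K) (E.localMinimalIntegralModel v)
    hΔm (LocalIndex.noroot_of_not_splits (E.localMinimalIntegralModel v) hc₄ hnsplits)
  -- `#Ẽ_ns(k_v) = q_v + 1`
  have hΔ0 : ((E.localMinimalIntegralModel v).map (residue (v.adicCompletionIntegers K))).Δ = 0 := by
    rw [map_Δ, residue_eq_zero_iff]; exact hΔm
  have hc₄0 : ((E.localMinimalIntegralModel v).map (residue (v.adicCompletionIntegers K))).c₄ ≠ 0 := by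
    rw [map_c₄, Ne, residue_eq_zero_iff]; exact hc₄
  have hcount := ((natCard_point_of_Δ_eq_zero
    ((E.localMinimalIntegralModel v).map (residue (v.adicCompletionIntegers K))) hΔ0).2.1 hc₄0
    (by rw [nodePoly_map_residue]; exact hnsplits))
  rw [hcount] at h
  -- arithmetic
  set T := (nsmulAddMonoidHom (p ^ k) :
    ((E.localMinimalIntegralModel v).baseChange (v.adicCompletion K)).toAffine.Point →+ _).ker with hT
  have hTne : Nat.card T ≠ 0 := fun h0 => by
    rw [h0, zero_dvd_iff] at h
    exact (mul_ne_zero hidx.1 (Nat.succ_ne_zero _)) h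
  haveI : Finite T := Nat.finite_of_card_ne_zero hTne
  have hcop : Nat.Coprime (Nat.card T) 2 :=
    coprime_natCard_of_prime_pow_nsmul_eq_zero hp (k := k) (fun x => Subtype.ext x.2)
      (fun h2 => hp2 ((Nat.prime_dvd_prime_iff_eq hp Nat.prime_two).mp h2))
  obtain ⟨hne, hle⟩ := hidx
  interval_cases hI : ((E.localMinimalIntegralModel v).nonsingularReductionSubgroup
      (integers_valuationRing_valuation (v.adicCompletionIntegers K) (v.adicCompletion K))).index
  · exact (hne rfl).elim
  · rwa [one_mul] at h
  · exact hcop.dvd_of_dvd_mul_left h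

/-- **Additive reduction, `p ≥ 5`: `E(K_v)[p^k] = 0`** at `v ∤ p` (Silverman, *AEC* VII.2.1, VII.3.1,
VII.6.1): `[X : E₀] ≤ 4` (Kodaira–Néron, `index_goodReductionSubgroup_le_four_holds`) and
`#Ẽ_ns(k_v) = q_v` at a cusp (`natCard_point_of_Δ_eq_zero`), both prime to `p`. This is
"`c_w ≤ 4`, `Ẽ_ns(k_w) = 𝔾_a`" of the no-Tamagawa-defect binder. [cite: SilvermanAEC2009, Prop. VII.2.1, Prop. VII.3.1, Thm. VII.6.1]
[cite: SilvermanATAEC1994, Cor. IV.9.2(d)] [cite: Castella2018, Prop. 2.5] -/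
theorem natCard_primePowTorsion_eq_one_of_hasAdditiveReductionAt [E.IsElliptic]
    (hadd : E.HasAdditiveReductionAt v) {p : ℕ} (hp : p.Prime) (hp5 : 5 ≤ p)
    (hpv : (p : 𝓞 K) ∉ v.asIdeal) (k : ℕ) :
    Nat.card (nsmulAddMonoidHom (p ^ k) : (E.baseChange (v.adicCompletion K)).toAffine.Point →+ _).ker = 1 := by
  rw [natCard_torsion_baseChange_eq]
  have h := E.natCard_torsion_dvd_index_mul_natCard_reduction v
    (isUnit_natCast_pow_adicCompletionIntegers v hpv k)
  obtain ⟨hΔm, hc₄⟩ := (hasAdditiveReductionAt_iff_mem v E).mp hadd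
  have hX : (E.localMinimalIntegralModel v).baseChange (v.adicCompletion K) = E.localMinimalModel v :=
    E.map_localMinimalIntegralModel_eq (v := v)
  haveI : ((E.localMinimalIntegralModel v).baseChange (v.adicCompletion K)).IsMinimal
      (v.adicCompletionIntegers K) := E.isMinimal_map_localMinimalIntegralModel (v := v)
  haveI : ((E.localMinimalIntegralModel v).baseChange (v.adicCompletion K)).IsElliptic :=
    E.isElliptic_map_localMinimalIntegralModel (v := v)
  haveI : PerfectField (ResidueField (v.adicCompletionIntegers K)) := PerfectField.ofFinite
  have hadd' : ((E.localMinimalIntegralModel v).baseChange (v.adicCompletion K)).HasAdditiveReduction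
      (v.adicCompletionIntegers K) := by
    rw [hX]; exact hadd
  have hnotsplit : ¬ ((E.localMinimalIntegralModel v).baseChange (v.adicCompletion K)).HasSplitMultiplicativeReduction
      (v.adicCompletionIntegers K) :=
    fun hs => HasAdditiveReduction.not_hasMultiplicativeReduction (v.adicCompletionIntegers K) hadd'
      hs.toHasMultiplicativeReduction
  have hidx := index_goodReductionSubgroup_le_four_holds (v.adicCompletionIntegers K)
    (W := (E.localMinimalIntegralModel v).baseChange (v.adicCompletion K)) hnotsplit
  rw [goodReductionSubgroup_baseChange_eq] at hidx
  -- `#Ẽ_ns(k_v) = q_v` (cusp)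
  have hΔ0 : ((E.localMinimalIntegralModel v).map (residue (v.adicCompletionIntegers K))).Δ = 0 := by
    rw [map_Δ, residue_eq_zero_iff]; exact hΔm
  have hc₄0 : ((E.localMinimalIntegralModel v).map (residue (v.adicCompletionIntegers K))).c₄ = 0 := by
    rw [map_c₄, residue_eq_zero_iff]; exact hc₄
  have hcount := (natCard_point_of_Δ_eq_zero
    ((E.localMinimalIntegralModel v).map (residue (v.adicCompletionIntegers K))) hΔ0).2.2 hc₄0
  rw [hcount] at h
  -- arithmetic
  set T := (nsmulAddMonoidHom (p ^ k) :
    ((E.localMinimalIntegralModel v).baseChange (v.adicCompletion K)).toAffine.Point →+ _).ker with hT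
  obtain ⟨hne, hle⟩ := hidx
  have hTne : Nat.card T ≠ 0 := fun h0 => by
    rw [h0, zero_dvd_iff] at h
    exact (mul_ne_zero hne (Nat.card_pos (α := ResidueField (v.adicCompletionIntegers K))).ne') h
  haveI : Finite T := Nat.finite_of_card_ne_zero hTne
  have hpm : ¬ p ∣ ((E.localMinimalIntegralModel v).nonsingularReductionSubgroup
      (integers_valuationRing_valuation (v.adicCompletionIntegers K) (v.adicCompletion K))).index *
      Nat.card (ResidueField (v.adicCompletionIntegers K)) := by
    intro hdvd
    rcases (Nat.Prime.dvd_mul hp).mp hdvd with h1 | h2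
    · have := Nat.le_of_dvd (Nat.pos_of_ne_zero hne) h1
      omega
    · exact not_dvd_natCard_residueField v hp hpv h2
  have hcop := coprime_natCard_of_prime_pow_nsmul_eq_zero hp (k := k) (fun x : T => Subtype.ext x.2) hpm
  exact Nat.Coprime.eq_one_of_dvd hcop h

end WeierstrassCurve

end
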